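import Mathlib.LinearAlgebra.Matrix.Permanent
import Mathlib.Analysis.Complex.Basic
import HarnessLib

/-!
# Entrywise perturbation bounds for the permanent

Mathlib's `Matrix.permanent` (`per M = ∑_σ ∏_i M (σ i) i`) has no analytic API. This file proves
the elementary Lipschitz estimate of the permanent of a complex matrix in its entries:

* `Matrix.norm_permanent_le` — `‖per A‖ ≤ n! · Lⁿ` when all entries have norm `≤ L`;
* `Matrix.norm_permanent_sub_permanent_le` — `‖per A − per B‖ ≤ n! · n · Lⁿ · γ` when all entries
  of `A` and `B` have norm `≤ L` (`L ≥ 1`) and `‖A i j − B i j‖ ≤ γ` (telescoping each of the `n!`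
  products, `Matrix.norm_prod_sub_prod_le_card_mul`);
* `Matrix.abs_norm_sq_permanent_sub_le` — hence `| ‖per A‖² − ‖per B‖² | ≤ 2 · n · (n!)² · L²ⁿ · γ`.

These are the bounds through which an estimate of `|Per(X')|²` for a matrix `X'` entrywise close to
`X` is an estimate of `|Per(X)|²` — needed when Aaronson–Arkhipov's reduction (Theory of Computing 9
(2013), proof of Thm. 1.3, §5.2) is run at finite precision, where the planted block is a rounding of
the Gaussian input rather than the input itself (`Literature/Computability/QuantumComplexity/
ApproxBosonSamplingAccounting.lean`). Folklore; Mathlib-only; everything proved. Deliberate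
dot-notation extensions of Mathlib's `Matrix` namespace (searched: `permanent_sub`, `norm_permanent`,
`permanent_le` — nothing in Mathlib).

## References

* H. Minc, *Permanents*, Encyclopedia of Mathematics and its Applications 6 (1978), §1.1 (the
  defining expansion; the estimates are immediate from it).
* S. Aaronson, A. Arkhipov, *The computational complexity of linear optics*, Theory of Computing 9
  (2013) 143–252, §5.2 (where the estimate is used implicitly, "none of the relevant calculations are
  affected by precision issues", §2 p. 161).
-/

namespace Matrix

open Finset

variable {n : Type*} [DecidableEq n] [Fintype n]

/-- **Telescoping bound for products**: if `‖a i‖, ‖b i‖ ≤ L` (`L ≥ 1`) and `‖a i − b i‖ ≤ γ` on `s`,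
then `‖∏_s a − ∏_s b‖ ≤ |s| · L^{|s|} · γ`. [folklore] -/
theorem norm_prod_sub_prod_le_card_mul {ι : Type*} [DecidableEq ι] (s : Finset ι) {a b : ι → ℂ}
    {L γ : ℝ} (hL : 1 ≤ L) (hγ : 0 ≤ γ) (ha : ∀ i ∈ s, ‖a i‖ ≤ L) (hb : ∀ i ∈ s, ‖b i‖ ≤ L)
    (hab : ∀ i ∈ s, ‖a i - b i‖ ≤ γ) :
    ‖∏ i ∈ s, a i - ∏ i ∈ s, b i‖ ≤ s.card * L ^ s.card * γ := by
  induction s using Finset.induction_on with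
  | empty => simp
  | insert j s hj ih =>
    have ha' : ∀ i ∈ s, ‖a i‖ ≤ L := fun i hi => ha i (Finset.mem_insert_of_mem hi)
    have hb' : ∀ i ∈ s, ‖b i‖ ≤ L := fun i hi => hb i (Finset.mem_insert_of_mem hi)
    have hab' : ∀ i ∈ s, ‖a i - b i‖ ≤ γ := fun i hi => hab i (Finset.mem_insert_of_mem hi)
    have hih := ih ha' hb' hab'
    have hL0 : 0 ≤ L := zero_le_one.trans hL
    rw [Finset.prod_insert hj, Finset.prod_insert hj, Finset.card_insert_of_notMem hj]
    have hPb : ‖∏ i ∈ s, b i‖ ≤ L ^ s.card := by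
      rw [norm_prod]
      calc ∏ i ∈ s, ‖b i‖ ≤ ∏ _i ∈ s, L := Finset.prod_le_prod (fun i _ => norm_nonneg _) hb'
        _ = L ^ s.card := Finset.prod_const L
    have hdecomp : a j * ∏ i ∈ s, a i - b j * ∏ i ∈ s, b i =
        a j * (∏ i ∈ s, a i - ∏ i ∈ s, b i) + (a j - b j) * ∏ i ∈ s, b i := by ring
    rw [hdecomp]
    have hpow : L ^ s.card ≤ L ^ s.card * L := le_mul_of_one_le_right (pow_nonneg hL0 _) hL
    calc ‖a j * (∏ i ∈ s, a i - ∏ i ∈ s, b i) + (a j - b j) * ∏ i ∈ s, b i‖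
        ≤ ‖a j‖ * ‖∏ i ∈ s, a i - ∏ i ∈ s, b i‖ + ‖a j - b j‖ * ‖∏ i ∈ s, b i‖ := by
          rw [← norm_mul, ← norm_mul]; exact norm_add_le _ _
      _ ≤ L * (s.card * L ^ s.card * γ) + γ * L ^ s.card :=
          add_le_add (mul_le_mul (ha j (Finset.mem_insert_self j s)) hih (norm_nonneg _) hL0)
            (mul_le_mul (hab j (Finset.mem_insert_self j s)) hPb (norm_nonneg _) hγ)
      _ ≤ L * (s.card * L ^ s.card * γ) + γ * (L ^ s.card * L) := by gcongr
      _ = ((s.card + 1 : ℕ) : ℝ) * L ^ (s.card + 1) * γ := by push_cast; ring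

/-- **Products of bounded entries**: `‖∏_s a‖ ≤ L^{|s|}` if `‖a i‖ ≤ L` on `s`. [folklore] -/
theorem norm_prod_le_pow_card {ι : Type*} (s : Finset ι) {a : ι → ℂ} {L : ℝ}
    (ha : ∀ i ∈ s, ‖a i‖ ≤ L) : ‖∏ i ∈ s, a i‖ ≤ L ^ s.card := by
  rw [norm_prod]
  calc ∏ i ∈ s, ‖a i‖ ≤ ∏ _i ∈ s, L := Finset.prod_le_prod (fun i _ => norm_nonneg _) ha
    _ = L ^ s.card := Finset.prod_const L

/-- **`‖per A‖ ≤ n! · Lⁿ`** for a complex matrix whose entries have norm at most `L` (`n!` products of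
`n` entries). [folklore] -/
theorem norm_permanent_le (A : Matrix n n ℂ) {L : ℝ} (hA : ∀ i j, ‖A i j‖ ≤ L) :
    ‖A.permanent‖ ≤ (Fintype.card n).factorial * L ^ Fintype.card n := by
  unfold Matrix.permanent
  calc ‖∑ σ : Equiv.Perm n, ∏ i, A (σ i) i‖ ≤ ∑ σ : Equiv.Perm n, ‖∏ i, A (σ i) i‖ :=
        norm_sum_le _ _
    _ ≤ ∑ _σ : Equiv.Perm n, L ^ Fintype.card n :=
        Finset.sum_le_sum fun σ _ => norm_prod_le_pow_card _ fun i _ => hA _ _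
    _ = (Fintype.card n).factorial * L ^ Fintype.card n := by
        rw [Finset.sum_const, Finset.card_univ, Fintype.card_perm, nsmul_eq_mul]

/-- **Lipschitz bound for the permanent**: if all entries of `A` and `B` have norm `≤ L` (`L ≥ 1`)
and corresponding entries differ by at most `γ` in norm, then
`‖per A − per B‖ ≤ n! · (n · Lⁿ · γ)`. [folklore] -/
theorem norm_permanent_sub_permanent_le (A B : Matrix n n ℂ) {L γ : ℝ} (hL : 1 ≤ L) (hγ : 0 ≤ γ)
    (hA : ∀ i j, ‖A i j‖ ≤ L) (hB : ∀ i j, ‖B i j‖ ≤ L) (hAB : ∀ i j, ‖A i j - B i j‖ ≤ γ) :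
    ‖A.permanent - B.permanent‖ ≤
      (Fintype.card n).factorial * (Fintype.card n * L ^ Fintype.card n * γ) := by
  unfold Matrix.permanent
  rw [← Finset.sum_sub_distrib]
  calc ‖∑ σ : Equiv.Perm n, (∏ i, A (σ i) i - ∏ i, B (σ i) i)‖
      ≤ ∑ σ : Equiv.Perm n, ‖∏ i, A (σ i) i - ∏ i, B (σ i) i‖ := norm_sum_le _ _
    _ ≤ ∑ _σ : Equiv.Perm n, (Fintype.card n * L ^ Fintype.card n * γ) :=
        Finset.sum_le_sum fun σ _ =>
          norm_prod_sub_prod_le_card_mul _ hL hγ (fun i _ => hA _ _) (fun i _ => hB _ _)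
            fun i _ => hAB _ _
    _ = (Fintype.card n).factorial * (Fintype.card n * L ^ Fintype.card n * γ) := by
        rw [Finset.sum_const, Finset.card_univ, Fintype.card_perm, nsmul_eq_mul]

/-- **Perturbation of `|per|²`**: under the same hypotheses,
`| ‖per A‖² − ‖per B‖² | ≤ 2 · n · (n!)² · L²ⁿ · γ`
(`|a² − b²| = |a − b| (a + b)` with `‖per A − per B‖ ≤ n!·n·Lⁿ·γ` and `‖per A‖, ‖per B‖ ≤ n!·Lⁿ`).
[folklore] -/
theorem abs_norm_sq_permanent_sub_le (A B : Matrix n n ℂ) {L γ : ℝ} (hL : 1 ≤ L) (hγ : 0 ≤ γ)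
    (hA : ∀ i j, ‖A i j‖ ≤ L) (hB : ∀ i j, ‖B i j‖ ≤ L) (hAB : ∀ i j, ‖A i j - B i j‖ ≤ γ) :
    |‖A.permanent‖ ^ 2 - ‖B.permanent‖ ^ 2| ≤
      2 * Fintype.card n * ((Fintype.card n).factorial : ℝ) ^ 2 * L ^ (2 * Fintype.card n) * γ := by
  set k : ℕ := Fintype.card n
  have hL0 : 0 ≤ L := zero_le_one.trans hL
  have h1 : |‖A.permanent‖ - ‖B.permanent‖| ≤ k.factorial * (k * L ^ k * γ) :=
    (abs_norm_sub_norm_le _ _).trans (norm_permanent_sub_permanent_le A B hL hγ hA hB hAB)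
  have h2 : ‖A.permanent‖ + ‖B.permanent‖ ≤ 2 * (k.factorial * L ^ k) := by
    have := norm_permanent_le A hA
    have := norm_permanent_le B hB
    linarith
  have hfac : |‖A.permanent‖ ^ 2 - ‖B.permanent‖ ^ 2| =
      |‖A.permanent‖ - ‖B.permanent‖| * (‖A.permanent‖ + ‖B.permanent‖) := by
    rw [sq_sub_sq, abs_mul, abs_of_nonneg (by positivity), mul_comm]
  rw [hfac]
  calc |‖A.permanent‖ - ‖B.permanent‖| * (‖A.permanent‖ + ‖B.permanent‖)
      ≤ k.factorial * (k * L ^ k * γ) * (2 * (k.factorial * L ^ k)) :=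
        mul_le_mul h1 h2 (by positivity) (by positivity)
    _ = 2 * k * (k.factorial : ℝ) ^ 2 * L ^ (2 * k) * γ := by ring

end Matrix
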